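import Summits.CriticalPhenomena.PercolationContinuityZ3.Theorems.PercNearOneGluingNoHeavyLowerTailKnQuestion8CoefficientwiseSeries
import HarnessLib

/-!
# CONJECTURE NO-CORE is closed under SERIES composition — prim-lf-2 gen 55

Support file (`--supports stmt-CriticalPhenomena-4575`, closed), prover `prim-lf-2` (gen 55).  No definitions, no named facts, no sorries; standard axioms.
Memo `prim-lf-2/CW-TWOSOURCESYM-gen55.md` §3.  Template: gen 26's `…CoefficientwiseSeries.lean` (THEOREM SP (b) for the WALL class `𝒞`).

The class `𝒩`.  For a finite multigraph `ends : ι → Sym2 V`, an edge set `E ⊆ ι` and vertices `x, y`, say `(E; x, y) ∈ 𝒩` if for all monotone `f, g : Set V → ℝ`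
  `NO-CORE_E(y)[f,g] := Σ_{s ⊆ E : ¬(y ∈ C_x(s) ∧ y ∈ C_x(E∖s))} (f(C_x s) − f(C_x(E∖s)))·(g(C_x s) − g(C_x(E∖s))) ≥ 0`
(`C_x(s) = openCluster (ends '' s) x`; the constraint says '`y` is not joined to `x` in BOTH colours' — CONJECTURE NO-CORE of prim-lf-2 gen 46, census-clean on all graphs with
≤ 8 vertices and ≤ 12 edges; it contains the WALL class statement CW-PA only through `NO-CORE = 2·OFF − WALL`).  Trivial members: `y ∼ x` (then `NO-CORE = 2·OFF ≥ 0`, gen 46) and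
every `(E; x, y)` in which no colouring joins `y` to `x` in both colours (then the sum is the full two-colouring Harris sum).
* `Coefficientwise.noCore_series_core` — **THEOREM (series closure of `𝒩`)**: let `E₁, E₂` be disjoint edge sets whose edges can only share the vertex `v`, `x` meeting no
  `E₂`-edge and `y ≠ x` meeting no `E₁`-edge.  If `(E₂; v, y) ∈ 𝒩`, and `(E₁; x, v) ∈ 𝒩` whenever some colouring of `E₂` joins `v` to `y` in both colours, then
  `(E₁ ∪ E₂; x, y) ∈ 𝒩`.  `noCore_series` is the plain form, `noCore_series_of_noDoublePath` the form in which the `E₁`-hypothesis is void.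
Proof.  A colouring of `E₁ ∪ E₂` is a pair `(s₁,s₂)`; the clusters glue as `K = K₁ ∪ [v∈K₁]K₂`, `K̄ = K̄₁ ∪ [v∈K̄₁]K̄₂` (`mem_openCluster_union_glue`), and
`y ∈ K ∩ K̄ ⟺ (v ∈ K₁ ∧ y ∈ K₂) ∧ (v ∈ K̄₁ ∧ y ∈ K̄₂)`.  Split by the `y`-side statistic: (i) if `s₂` does NOT join `v` to `y` in both colours, EVERY `s₁` is admissible, the
summand is a product of two functions monotone in `s₁`, so FKG on `E₁.powerset` (`fkg_powerset`) and the colour swap on `E₁` bound the block below by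
`2^{-|E₁|}·(Ψf(K₂) − Ψf(K̄₂))(Ψg(K₂) − Ψg(K̄₂))` with `Ψf(W) = Σ_{s₁} f(K₁ ∪ [v∈K₁]W)` monotone; summed over these `s₂` this is `2^{-|E₁|}·NO-CORE_{E₂}(y)[Ψf,Ψg] ≥ 0`
(second hypothesis) — the three blocks `(0,0),(1,0),(0,1)` of THEOREM SP merge into one here; (ii) if `s₂` joins `v` to `y` in both colours, the constraint is `v ∉ K₁ ∩ K̄₁`,
and pairing `s₂` with its complement `E₂ ∖ s₂` turns the two inner sums into `NO-CORE_{E₁}(v)[φ_R,γ_R] + NO-CORE_{E₁}(v)[φ_B,γ_B]` with the monotone 'glued' functions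
`φ_R(X) = f(X ∪ [v∈X]K₂(s₂))`, `φ_B(X) = f(X ∪ [v∈X]K̄₂(s₂))` (pointwise identity on `{v ∉ K₁ ∩ K̄₁}`), nonnegative by the first hypothesis.
Consequence (memo §3): NO-CORE(y) holds for all monotone `f, g` on every graph whose `x–y` block path consists of blocks each containing an edge between its two attachment
vertices (or a bridge), with arbitrary blocks hung elsewhere — the first infinite all-`(f,g)` class beyond `y ∼ x`.  Exact pre-check of the block signs (prim-lf-2 gen 55,
code/gen55/c/spblocks.c): 232 245 series compositions `(G₁,G₂,u)` with ≤ 8 vertices, 0 negative blocks.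
[cite: KozmaNitzan2024, Questions 8–9 (§5.5 p. 36) (context: the Question-8 pocket covariance programme)]
-/

namespace Summit.CriticalPhenomena.PercolationContinuityZ3.Theorems

open Finset Literature.Probability.Percolation

namespace Coefficientwise

variable {ι V : Type*} [Fintype ι] [DecidableEq ι]

open Classical in
/-- **Series closure of the NO-CORE class, core form.**  Let `E₁, E₂ ⊆ ι` be disjoint edge sets of a finite multigraph `ends : ι → Sym2 V` such that an `E₁`-edge and an
`E₂`-edge can only share the vertex `v`; let `x` meet no `E₂`-edge and `y ≠ x` meet no `E₁`-edge.  If `(E₂; v, y)` satisfies NO-CORE, and `(E₁; x, v)` does whenever some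
colouring of `E₂` joins `v` to `y` in both colours, then `(E₁ ∪ E₂; x, y)` satisfies NO-CORE:
`0 ≤ Σ_{s ⊆ E₁∪E₂ : ¬(y ∈ C_x s ∧ y ∈ C_x(E∖s))} (f(C_x s) − f(C_x(E∖s)))(g(C_x s) − g(C_x(E∖s)))` for all monotone `f, g`.
[cite: KozmaNitzan2024, Questions 8–9 (§5.5 p. 36) (context)] -/
theorem noCore_series_core (ends : ι → Sym2 V) {E₁ E₂ : Finset ι} (hE : Disjoint E₁ E₂) {x v y : V}
    (hsep : ∀ e ∈ E₁, ∀ e' ∈ E₂, ∀ w : V, w ∈ ends e → w ∈ ends e' → w = v)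
    (hx : ∀ e ∈ E₂, x ∉ ends e) (hy : ∀ e ∈ E₁, y ∉ ends e) (hyx : y ≠ x)
    (h₁ : (∃ s₂, s₂ ⊆ E₂ ∧ y ∈ openCluster (ends '' (↑s₂ : Set ι)) v ∧ y ∈ openCluster (ends '' (↑(E₂ \ s₂) : Set ι)) v) →
      ∀ φ ψ : Set V → ℝ, Monotone φ → Monotone ψ →
      0 ≤ ∑ s ∈ E₁.powerset.filter (fun s : Finset ι => ¬ (v ∈ openCluster (ends '' (↑s : Set ι)) x ∧
            v ∈ openCluster (ends '' (↑(E₁ \ s) : Set ι)) x)),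
        (φ (openCluster (ends '' (↑s : Set ι)) x) - φ (openCluster (ends '' (↑(E₁ \ s) : Set ι)) x)) *
          (ψ (openCluster (ends '' (↑s : Set ι)) x) - ψ (openCluster (ends '' (↑(E₁ \ s) : Set ι)) x)))
    (h₂ : ∀ φ ψ : Set V → ℝ, Monotone φ → Monotone ψ →
      0 ≤ ∑ s ∈ E₂.powerset.filter (fun s : Finset ι => ¬ (y ∈ openCluster (ends '' (↑s : Set ι)) v ∧
            y ∈ openCluster (ends '' (↑(E₂ \ s) : Set ι)) v)),
        (φ (openCluster (ends '' (↑s : Set ι)) v) - φ (openCluster (ends '' (↑(E₂ \ s) : Set ι)) v)) *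
          (ψ (openCluster (ends '' (↑s : Set ι)) v) - ψ (openCluster (ends '' (↑(E₂ \ s) : Set ι)) v)))
    (f g : Set V → ℝ) (hf : Monotone f) (hg : Monotone g) :
    0 ≤ ∑ s ∈ (E₁ ∪ E₂).powerset.filter (fun s : Finset ι => ¬ (y ∈ openCluster (ends '' (↑s : Set ι)) x ∧
          y ∈ openCluster (ends '' (↑((E₁ ∪ E₂) \ s) : Set ι)) x)),
      (f (openCluster (ends '' (↑s : Set ι)) x) - f (openCluster (ends '' (↑((E₁ ∪ E₂) \ s) : Set ι)) x)) *
        (g (openCluster (ends '' (↑s : Set ι)) x) - g (openCluster (ends '' (↑((E₁ ∪ E₂) \ s) : Set ι)) x)) := by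
  -- notation: red clusters of `x` and of `v`, and the gluing operation at `v`
  set K : Finset ι → Set V := fun s => openCluster (ends '' (↑s : Set ι)) x with hK
  set Kv : Finset ι → Set V := fun s => openCluster (ends '' (↑s : Set ι)) v with hKv
  set gl : Set V → Set V → Set V := fun X W => X ∪ {w | v ∈ X ∧ w ∈ W} with hgl
  change 0 ≤ ∑ s ∈ (E₁ ∪ E₂).powerset.filter (fun s => ¬ (y ∈ K s ∧ y ∈ K ((E₁ ∪ E₂) \ s))),
      (f (K s) - f (K ((E₁ ∪ E₂) \ s))) * (g (K s) - g (K ((E₁ ∪ E₂) \ s)))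
  have h₁' : (∃ s₂, s₂ ⊆ E₂ ∧ y ∈ Kv s₂ ∧ y ∈ Kv (E₂ \ s₂)) → ∀ φ ψ : Set V → ℝ, Monotone φ → Monotone ψ →
      0 ≤ ∑ s ∈ E₁.powerset.filter (fun s => ¬ (v ∈ K s ∧ v ∈ K (E₁ \ s))),
        (φ (K s) - φ (K (E₁ \ s))) * (ψ (K s) - ψ (K (E₁ \ s))) := h₁
  have h₂' : ∀ φ ψ : Set V → ℝ, Monotone φ → Monotone ψ →
      0 ≤ ∑ s ∈ E₂.powerset.filter (fun s => ¬ (y ∈ Kv s ∧ y ∈ Kv (E₂ \ s))),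
        (φ (Kv s) - φ (Kv (E₂ \ s))) * (ψ (Kv s) - ψ (Kv (E₂ \ s))) := h₂
  -- basic facts
  have hKmono : ∀ {s t : Finset ι}, s ⊆ t → K s ⊆ K t := fun hst => openCluster_image_mono ends hst x
  have mem_gl : ∀ (X W : Set V) (w : V), w ∈ gl X W ↔ w ∈ X ∨ (v ∈ X ∧ w ∈ W) := fun X W w => by
    simp only [hgl, Set.mem_union, Set.mem_setOf_eq]
  have gl_of_not : ∀ X W : Set V, v ∉ X → gl X W = X := by
    intro X W hv; ext w; rw [mem_gl]; tauto
  have gl_mono_left : ∀ {X X' : Set V} (W : Set V), X ⊆ X' → gl X W ⊆ gl X' W := by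
    intro X X' W h w hw
    rw [mem_gl] at hw ⊢
    rcases hw with hw | ⟨hv, hw⟩
    · exact Or.inl (h hw)
    · exact Or.inr ⟨h hv, hw⟩
  have gl_mono_right : ∀ (X : Set V) {W W' : Set V}, W ⊆ W' → gl X W ⊆ gl X W' := by
    intro X W W' h w hw
    rw [mem_gl] at hw ⊢
    rcases hw with hw | ⟨hv, hw⟩
    · exact Or.inl hw
    · exact Or.inr ⟨hv, h hw⟩
  have hyK : ∀ s₁ : Finset ι, s₁ ⊆ E₁ → y ∉ K s₁ := fun s₁ hs₁ =>
    not_mem_openCluster_of_forall_not_mem ends (fun e he => hy e (hs₁ he)) hyx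
  have mem_gl_iff : ∀ (X W : Set V), y ∉ X → (y ∈ gl X W ↔ (v ∈ X ∧ y ∈ W)) := by
    intro X W hyX; rw [mem_gl]; tauto
  -- cluster decomposition under gluing at `v`
  have decomp : ∀ s₁ s₂ : Finset ι, s₁ ⊆ E₁ → s₂ ⊆ E₂ → K (s₁ ∪ s₂) = gl (K s₁) (Kv s₂) := by
    intro s₁ s₂ hs₁ hs₂
    ext w
    rw [mem_gl]
    exact mem_openCluster_union_glue ends (fun e he e' he' w hw hw' => hsep e (hs₁ he) e' (hs₂ he') w hw hw')
      (fun e he hxe => absurd hxe (hx e (hs₂ he))) w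
  -- the sum over colourings of `E₁ ∪ E₂` as a double sum, each summand in glued form
  simp only [Finset.sum_filter]
  rw [DualBHK.sum_powerset_union hE, Finset.sum_comm]
  have hsummand : ∀ s₂ ∈ E₂.powerset, ∀ s₁ ∈ E₁.powerset,
      (if ¬ (y ∈ K (s₁ ∪ s₂) ∧ y ∈ K ((E₁ ∪ E₂) \ (s₁ ∪ s₂)))
        then (f (K (s₁ ∪ s₂)) - f (K ((E₁ ∪ E₂) \ (s₁ ∪ s₂)))) *
          (g (K (s₁ ∪ s₂)) - g (K ((E₁ ∪ E₂) \ (s₁ ∪ s₂)))) else 0)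
      = (if ¬ ((v ∈ K s₁ ∧ y ∈ Kv s₂) ∧ (v ∈ K (E₁ \ s₁) ∧ y ∈ Kv (E₂ \ s₂)))
        then (f (gl (K s₁) (Kv s₂)) - f (gl (K (E₁ \ s₁)) (Kv (E₂ \ s₂)))) *
          (g (gl (K s₁) (Kv s₂)) - g (gl (K (E₁ \ s₁)) (Kv (E₂ \ s₂)))) else 0) := by
    intro s₂ hs₂ s₁ hs₁
    have hs₁' := Finset.mem_powerset.mp hs₁
    have hs₂' := Finset.mem_powerset.mp hs₂
    have hK12 : K (s₁ ∪ s₂) = gl (K s₁) (Kv s₂) := decomp s₁ s₂ hs₁' hs₂'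
    have hKc : K ((E₁ ∪ E₂) \ (s₁ ∪ s₂)) = gl (K (E₁ \ s₁)) (Kv (E₂ \ s₂)) := by
      rw [union_sdiff_union_of_subset hE hs₁' hs₂']
      exact decomp (E₁ \ s₁) (E₂ \ s₂) Finset.sdiff_subset Finset.sdiff_subset
    have hcond : (¬ (y ∈ K (s₁ ∪ s₂) ∧ y ∈ K ((E₁ ∪ E₂) \ (s₁ ∪ s₂)))) ↔
        (¬ ((v ∈ K s₁ ∧ y ∈ Kv s₂) ∧ (v ∈ K (E₁ \ s₁) ∧ y ∈ Kv (E₂ \ s₂)))) := by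
      rw [hK12, hKc]
      exact not_congr (and_congr (mem_gl_iff _ _ (hyK s₁ hs₁')) (mem_gl_iff _ _ (hyK _ Finset.sdiff_subset)))
    by_cases hc : ¬ (y ∈ K (s₁ ∪ s₂) ∧ y ∈ K ((E₁ ∪ E₂) \ (s₁ ∪ s₂)))
    · rw [if_pos hc, if_pos (hcond.mp hc), hK12, hKc]
    · rw [if_neg hc, if_neg (fun h => hc (hcond.mpr h))]
  rw [Finset.sum_congr rfl fun s₂ hs₂ => Finset.sum_congr rfl fun s₁ hs₁ => hsummand s₂ hs₂ s₁ hs₁]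
  -- the inner sum, as a function of the colouring `s₂` of `E₂`
  set I : Finset ι → ℝ := fun s₂ => ∑ s₁ ∈ E₁.powerset,
      (if ¬ ((v ∈ K s₁ ∧ y ∈ Kv s₂) ∧ (v ∈ K (E₁ \ s₁) ∧ y ∈ Kv (E₂ \ s₂)))
        then (f (gl (K s₁) (Kv s₂)) - f (gl (K (E₁ \ s₁)) (Kv (E₂ \ s₂)))) *
          (g (gl (K s₁) (Kv s₂)) - g (gl (K (E₁ \ s₁)) (Kv (E₂ \ s₂)))) else 0) with hI
  -- block (ii): `s₂` joins `v` to `y` in both colours — the glued NO-CORE sum on `E₁` with the functions `X ↦ f (gl X W)`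
  have blockA : ∀ s₂, s₂ ⊆ E₂ → y ∈ Kv s₂ → y ∈ Kv (E₂ \ s₂) → ∀ W : Set V,
      0 ≤ ∑ s₁ ∈ E₁.powerset, (if ¬ (v ∈ K s₁ ∧ v ∈ K (E₁ \ s₁))
        then (f (gl (K s₁) W) - f (gl (K (E₁ \ s₁)) W)) * (g (gl (K s₁) W) - g (gl (K (E₁ \ s₁)) W)) else 0) := by
    intro s₂ hs₂ hz1 hz2 W
    have := h₁' ⟨s₂, hs₂, hz1, hz2⟩ (fun X => f (gl X W)) (fun X => g (gl X W))
      (fun X X' h => hf (gl_mono_left W h)) (fun X X' h => hg (gl_mono_left W h))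
    rw [Finset.sum_filter] at this
    exact this
  -- the pairing identity on block (ii): `I s₂ + I (E₂ \ s₂)` is a sum of two glued NO-CORE sums on `E₁`
  have pairA : ∀ s₂, s₂ ⊆ E₂ → y ∈ Kv s₂ → y ∈ Kv (E₂ \ s₂) →
      I s₂ + I (E₂ \ s₂) =
        ∑ s₁ ∈ E₁.powerset, (if ¬ (v ∈ K s₁ ∧ v ∈ K (E₁ \ s₁))
          then (f (gl (K s₁) (Kv s₂)) - f (gl (K (E₁ \ s₁)) (Kv s₂))) * (g (gl (K s₁) (Kv s₂)) - g (gl (K (E₁ \ s₁)) (Kv s₂))) else 0)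
        + ∑ s₁ ∈ E₁.powerset, (if ¬ (v ∈ K s₁ ∧ v ∈ K (E₁ \ s₁))
          then (f (gl (K s₁) (Kv (E₂ \ s₂))) - f (gl (K (E₁ \ s₁)) (Kv (E₂ \ s₂)))) *
            (g (gl (K s₁) (Kv (E₂ \ s₂))) - g (gl (K (E₁ \ s₁)) (Kv (E₂ \ s₂)))) else 0) := by
    intro s₂ hs₂ hz1 hz2
    have hss : E₂ \ (E₂ \ s₂) = s₂ := Finset.sdiff_sdiff_eq_self hs₂
    simp only [hI, hss]
    rw [← Finset.sum_add_distrib, ← Finset.sum_add_distrib]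
    refine Finset.sum_congr rfl fun s₁ _ => ?_
    by_cases h1 : v ∈ K s₁ <;> by_cases h2 : v ∈ K (E₁ \ s₁)
    · -- `v` in both: every condition fails
      have c1 : ¬ ¬ ((v ∈ K s₁ ∧ y ∈ Kv s₂) ∧ (v ∈ K (E₁ \ s₁) ∧ y ∈ Kv (E₂ \ s₂))) := fun h => h ⟨⟨h1, hz1⟩, ⟨h2, hz2⟩⟩
      have c2 : ¬ ¬ ((v ∈ K s₁ ∧ y ∈ Kv (E₂ \ s₂)) ∧ (v ∈ K (E₁ \ s₁) ∧ y ∈ Kv s₂)) := fun h => h ⟨⟨h1, hz2⟩, ⟨h2, hz1⟩⟩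
      have c3 : ¬ ¬ (v ∈ K s₁ ∧ v ∈ K (E₁ \ s₁)) := fun h => h ⟨h1, h2⟩
      rw [if_neg c1, if_neg c2, if_neg c3, if_neg c3]
    · -- `v ∈ K s₁` only
      have c1 : ¬ ((v ∈ K s₁ ∧ y ∈ Kv s₂) ∧ (v ∈ K (E₁ \ s₁) ∧ y ∈ Kv (E₂ \ s₂))) := fun h => h2 h.2.1
      have c2 : ¬ ((v ∈ K s₁ ∧ y ∈ Kv (E₂ \ s₂)) ∧ (v ∈ K (E₁ \ s₁) ∧ y ∈ Kv s₂)) := fun h => h2 h.2.1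
      have c3 : ¬ (v ∈ K s₁ ∧ v ∈ K (E₁ \ s₁)) := fun h => h2 h.2
      rw [if_pos c1, if_pos c2, if_pos c3, if_pos c3, gl_of_not _ (Kv (E₂ \ s₂)) h2, gl_of_not _ (Kv s₂) h2]
    · -- `v ∈ K (E₁ \ s₁)` only
      have c1 : ¬ ((v ∈ K s₁ ∧ y ∈ Kv s₂) ∧ (v ∈ K (E₁ \ s₁) ∧ y ∈ Kv (E₂ \ s₂))) := fun h => h1 h.1.1
      have c2 : ¬ ((v ∈ K s₁ ∧ y ∈ Kv (E₂ \ s₂)) ∧ (v ∈ K (E₁ \ s₁) ∧ y ∈ Kv s₂)) := fun h => h1 h.1.1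
      have c3 : ¬ (v ∈ K s₁ ∧ v ∈ K (E₁ \ s₁)) := fun h => h1 h.1
      rw [if_pos c1, if_pos c2, if_pos c3, if_pos c3, gl_of_not _ (Kv (E₂ \ s₂)) h1, gl_of_not _ (Kv s₂) h1]
      ring
    · -- `v` in neither
      have c1 : ¬ ((v ∈ K s₁ ∧ y ∈ Kv s₂) ∧ (v ∈ K (E₁ \ s₁) ∧ y ∈ Kv (E₂ \ s₂))) := fun h => h1 h.1.1
      have c2 : ¬ ((v ∈ K s₁ ∧ y ∈ Kv (E₂ \ s₂)) ∧ (v ∈ K (E₁ \ s₁) ∧ y ∈ Kv s₂)) := fun h => h1 h.1.1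
      have c3 : ¬ (v ∈ K s₁ ∧ v ∈ K (E₁ \ s₁)) := fun h => h1 h.1
      rw [if_pos c1, if_pos c2, if_pos c3, if_pos c3, gl_of_not _ (Kv (E₂ \ s₂)) h1, gl_of_not _ (Kv s₂) h1,
        gl_of_not _ (Kv (E₂ \ s₂)) h2, gl_of_not _ (Kv s₂) h2]
  -- block (i): FKG on the colourings of `E₁` and the swap
  set Ψf : Set V → ℝ := fun W => ∑ s₁ ∈ E₁.powerset, f (gl (K s₁) W) with hΨf
  set Ψg : Set V → ℝ := fun W => ∑ s₁ ∈ E₁.powerset, g (gl (K s₁) W) with hΨg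
  have hΨf_mono : Monotone Ψf := fun W W' h => Finset.sum_le_sum fun s₁ _ => hf (gl_mono_right _ h)
  have hΨg_mono : Monotone Ψg := fun W W' h => Finset.sum_le_sum fun s₁ _ => hg (gl_mono_right _ h)
  have sumFf : ∀ W W' : Set V,
      ∑ s₁ ∈ E₁.powerset, (f (gl (K s₁) W) - f (gl (K (E₁ \ s₁)) W')) = Ψf W - Ψf W' := by
    intro W W'
    have e : ∑ s₁ ∈ E₁.powerset, f (gl (K (E₁ \ s₁)) W') = ∑ s₁ ∈ E₁.powerset, f (gl (K s₁) W') :=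
      sum_powerset_sdiff E₁ (fun t => f (gl (K t) W'))
    rw [Finset.sum_sub_distrib, e]
  have sumFg : ∀ W W' : Set V,
      ∑ s₁ ∈ E₁.powerset, (g (gl (K s₁) W) - g (gl (K (E₁ \ s₁)) W')) = Ψg W - Ψg W' := by
    intro W W'
    have e : ∑ s₁ ∈ E₁.powerset, g (gl (K (E₁ \ s₁)) W') = ∑ s₁ ∈ E₁.powerset, g (gl (K s₁) W') :=
      sum_powerset_sdiff E₁ (fun t => g (gl (K t) W'))
    rw [Finset.sum_sub_distrib, e]
  have blockD : ∀ W W' : Set V,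
      (∑ s₁ ∈ E₁.powerset, (f (gl (K s₁) W) - f (gl (K (E₁ \ s₁)) W'))) *
        (∑ s₁ ∈ E₁.powerset, (g (gl (K s₁) W) - g (gl (K (E₁ \ s₁)) W'))) ≤
      (2 ^ E₁.card : ℝ) * ∑ s₁ ∈ E₁.powerset,
        (f (gl (K s₁) W) - f (gl (K (E₁ \ s₁)) W')) * (g (gl (K s₁) W) - g (gl (K (E₁ \ s₁)) W')) := by
    intro W W'
    set F : Finset ι → ℝ := fun t => f (gl (K (t ∩ E₁)) W) - f (gl (K (E₁ \ t)) W') with hF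
    set G : Finset ι → ℝ := fun t => g (gl (K (t ∩ E₁)) W) - g (gl (K (E₁ \ t)) W') with hG
    have hFm : Monotone F := by
      intro a b hab
      simp only [hF]
      have h1 : f (gl (K (a ∩ E₁)) W) ≤ f (gl (K (b ∩ E₁)) W) :=
        hf (gl_mono_left W (hKmono (Finset.inter_subset_inter_right hab)))
      have h2 : f (gl (K (E₁ \ b)) W') ≤ f (gl (K (E₁ \ a)) W') :=
        hf (gl_mono_left W' (hKmono (Finset.sdiff_subset_sdiff (le_refl E₁) hab)))
      linarith
    have hGm : Monotone G := by
      intro a b hab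
      simp only [hG]
      have h1 : g (gl (K (a ∩ E₁)) W) ≤ g (gl (K (b ∩ E₁)) W) :=
        hg (gl_mono_left W (hKmono (Finset.inter_subset_inter_right hab)))
      have h2 : g (gl (K (E₁ \ b)) W') ≤ g (gl (K (E₁ \ a)) W') :=
        hg (gl_mono_left W' (hKmono (Finset.sdiff_subset_sdiff (le_refl E₁) hab)))
      linarith
    have key := fkg_powerset E₁ F G hFm hGm
    have hFE : ∀ t ∈ E₁.powerset, F t = f (gl (K t) W) - f (gl (K (E₁ \ t)) W') := fun t ht => by
      simp only [hF, Finset.inter_eq_left.mpr (Finset.mem_powerset.mp ht)]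
    have hGE : ∀ t ∈ E₁.powerset, G t = g (gl (K t) W) - g (gl (K (E₁ \ t)) W') := fun t ht => by
      simp only [hG, Finset.inter_eq_left.mpr (Finset.mem_powerset.mp ht)]
    have e1 : ∑ t ∈ E₁.powerset, F t = ∑ t ∈ E₁.powerset, (f (gl (K t) W) - f (gl (K (E₁ \ t)) W')) :=
      Finset.sum_congr rfl hFE
    have e2 : ∑ t ∈ E₁.powerset, G t = ∑ t ∈ E₁.powerset, (g (gl (K t) W) - g (gl (K (E₁ \ t)) W')) :=
      Finset.sum_congr rfl hGE
    have e3 : ∑ t ∈ E₁.powerset, F t * G t = ∑ t ∈ E₁.powerset,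
        (f (gl (K t) W) - f (gl (K (E₁ \ t)) W')) * (g (gl (K t) W) - g (gl (K (E₁ \ t)) W')) :=
      Finset.sum_congr rfl fun t ht => by rw [hFE t ht, hGE t ht]
    rw [e1, e2, e3] at key
    exact key
  -- split the outer sum by the `y`-side statistic: both colours join `v` to `y`, or not
  rw [← Finset.sum_filter_add_sum_filter_not E₂.powerset (fun s₂ => ¬ (y ∈ Kv s₂ ∧ y ∈ Kv (E₂ \ s₂))) I]
  apply add_nonneg
  · -- block (i), summed over `s₂` NOT joining `v` to `y` in both colours: every `s₁` is admissible
    have hterm : ∀ s₂ ∈ E₂.powerset.filter (fun s₂ => ¬ (y ∈ Kv s₂ ∧ y ∈ Kv (E₂ \ s₂))),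
        (Ψf (Kv s₂) - Ψf (Kv (E₂ \ s₂))) * (Ψg (Kv s₂) - Ψg (Kv (E₂ \ s₂))) ≤ (2 ^ E₁.card : ℝ) * I s₂ := by
      intro s₂ hs₂
      obtain ⟨_, hnb⟩ := Finset.mem_filter.mp hs₂
      have hIs : I s₂ = ∑ s₁ ∈ E₁.powerset, (f (gl (K s₁) (Kv s₂)) - f (gl (K (E₁ \ s₁)) (Kv (E₂ \ s₂)))) *
          (g (gl (K s₁) (Kv s₂)) - g (gl (K (E₁ \ s₁)) (Kv (E₂ \ s₂)))) := by
        simp only [hI]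
        refine Finset.sum_congr rfl fun s₁ _ => ?_
        rw [if_pos (fun h => hnb ⟨h.1.2, h.2.2⟩)]
      rw [hIs, ← sumFf, ← sumFg]
      exact blockD _ _
    have hsum : ∑ s₂ ∈ E₂.powerset.filter (fun s₂ => ¬ (y ∈ Kv s₂ ∧ y ∈ Kv (E₂ \ s₂))),
          (Ψf (Kv s₂) - Ψf (Kv (E₂ \ s₂))) * (Ψg (Kv s₂) - Ψg (Kv (E₂ \ s₂))) ≤
        (2 ^ E₁.card : ℝ) * ∑ s₂ ∈ E₂.powerset.filter (fun s₂ => ¬ (y ∈ Kv s₂ ∧ y ∈ Kv (E₂ \ s₂))), I s₂ := by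
      rw [Finset.mul_sum]
      exact Finset.sum_le_sum hterm
    have h0 := h₂' Ψf Ψg hΨf_mono hΨg_mono
    have hpos : (0 : ℝ) < (2 ^ E₁.card : ℝ) := by positivity
    exact (mul_nonneg_iff_of_pos_left hpos).mp (h0.trans hsum)
  · -- block (ii): `s₂` joins `v` to `y` in both colours; pair `s₂` with `E₂ \ s₂`
    set P : Finset ι → Prop := fun s₂ => ¬ ¬ (y ∈ Kv s₂ ∧ y ∈ Kv (E₂ \ s₂)) with hP
    have hPc : ∀ s₂ ∈ E₂.powerset, P (E₂ \ s₂) ↔ P s₂ := by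
      intro s₂ hs₂
      simp only [hP, Finset.sdiff_sdiff_eq_self (Finset.mem_powerset.mp hs₂)]
      tauto
    -- the filtered sum is invariant under the complement on `E₂`
    have hswap : ∑ s₂ ∈ E₂.powerset.filter P, I s₂ = ∑ s₂ ∈ E₂.powerset.filter P, I (E₂ \ s₂) := by
      rw [Finset.sum_filter, Finset.sum_filter]
      rw [← sum_powerset_sdiff E₂ (fun t => if P t then I t else 0)]
      refine Finset.sum_congr rfl fun s₂ hs₂ => ?_
      rw [if_congr (hPc s₂ hs₂) rfl rfl]
    have htwice : 2 * ∑ s₂ ∈ E₂.powerset.filter P, I s₂ = ∑ s₂ ∈ E₂.powerset.filter P, (I s₂ + I (E₂ \ s₂)) := by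
      rw [two_mul, Finset.sum_add_distrib, ← hswap]
    have hnn : 0 ≤ ∑ s₂ ∈ E₂.powerset.filter P, (I s₂ + I (E₂ \ s₂)) := by
      refine Finset.sum_nonneg fun s₂ hs₂ => ?_
      obtain ⟨hs₂E, hPs⟩ := Finset.mem_filter.mp hs₂
      have hboth : y ∈ Kv s₂ ∧ y ∈ Kv (E₂ \ s₂) := by
        by_contra h; exact hPs h
      have hs₂' := Finset.mem_powerset.mp hs₂E
      rw [pairA s₂ hs₂' hboth.1 hboth.2]
      exact add_nonneg (blockA s₂ hs₂' hboth.1 hboth.2 (Kv s₂)) (blockA s₂ hs₂' hboth.1 hboth.2 (Kv (E₂ \ s₂)))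
    have : 0 ≤ 2 * ∑ s₂ ∈ E₂.powerset.filter P, I s₂ := by rw [htwice]; exact hnn
    linarith

open Classical in
/-- **Series closure of the NO-CORE class**, plain form: under the gluing hypotheses of `noCore_series_core`, `(E₁; x, v) ∈ 𝒩` and `(E₂; v, y) ∈ 𝒩` imply
`(E₁ ∪ E₂; x, y) ∈ 𝒩`.  [cite: KozmaNitzan2024, Questions 8–9 (§5.5 p. 36) (context)] -/
theorem noCore_series (ends : ι → Sym2 V) {E₁ E₂ : Finset ι} (hE : Disjoint E₁ E₂) {x v y : V}
    (hsep : ∀ e ∈ E₁, ∀ e' ∈ E₂, ∀ w : V, w ∈ ends e → w ∈ ends e' → w = v)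
    (hx : ∀ e ∈ E₂, x ∉ ends e) (hy : ∀ e ∈ E₁, y ∉ ends e) (hyx : y ≠ x)
    (h₁ : ∀ φ ψ : Set V → ℝ, Monotone φ → Monotone ψ →
      0 ≤ ∑ s ∈ E₁.powerset.filter (fun s : Finset ι => ¬ (v ∈ openCluster (ends '' (↑s : Set ι)) x ∧
            v ∈ openCluster (ends '' (↑(E₁ \ s) : Set ι)) x)),
        (φ (openCluster (ends '' (↑s : Set ι)) x) - φ (openCluster (ends '' (↑(E₁ \ s) : Set ι)) x)) *
          (ψ (openCluster (ends '' (↑s : Set ι)) x) - ψ (openCluster (ends '' (↑(E₁ \ s) : Set ι)) x)))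
    (h₂ : ∀ φ ψ : Set V → ℝ, Monotone φ → Monotone ψ →
      0 ≤ ∑ s ∈ E₂.powerset.filter (fun s : Finset ι => ¬ (y ∈ openCluster (ends '' (↑s : Set ι)) v ∧
            y ∈ openCluster (ends '' (↑(E₂ \ s) : Set ι)) v)),
        (φ (openCluster (ends '' (↑s : Set ι)) v) - φ (openCluster (ends '' (↑(E₂ \ s) : Set ι)) v)) *
          (ψ (openCluster (ends '' (↑s : Set ι)) v) - ψ (openCluster (ends '' (↑(E₂ \ s) : Set ι)) v)))
    (f g : Set V → ℝ) (hf : Monotone f) (hg : Monotone g) :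
    0 ≤ ∑ s ∈ (E₁ ∪ E₂).powerset.filter (fun s : Finset ι => ¬ (y ∈ openCluster (ends '' (↑s : Set ι)) x ∧
          y ∈ openCluster (ends '' (↑((E₁ ∪ E₂) \ s) : Set ι)) x)),
      (f (openCluster (ends '' (↑s : Set ι)) x) - f (openCluster (ends '' (↑((E₁ ∪ E₂) \ s) : Set ι)) x)) *
        (g (openCluster (ends '' (↑s : Set ι)) x) - g (openCluster (ends '' (↑((E₁ ∪ E₂) \ s) : Set ι)) x)) :=
  noCore_series_core ends hE hsep hx hy hyx (fun _ => h₁) h₂ f g hf hg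

open Classical in
/-- **Series composition when the `y`-side piece has no doubly connected colouring**: if no colouring of `E₂` joins `v` to `y` in BOTH colours (e.g. some single edge of `E₂`
separates `v` from `y`), block (ii) is empty and NO hypothesis on `(E₁; x, v)` is needed: `(E₂; v, y) ∈ 𝒩` alone gives `(E₁ ∪ E₂; x, y) ∈ 𝒩` for an ARBITRARY piece `E₁`.
[cite: KozmaNitzan2024, Questions 8–9 (§5.5 p. 36) (context)] -/
theorem noCore_series_of_noDoublePath (ends : ι → Sym2 V) {E₁ E₂ : Finset ι} (hE : Disjoint E₁ E₂) {x v y : V}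
    (hsep : ∀ e ∈ E₁, ∀ e' ∈ E₂, ∀ w : V, w ∈ ends e → w ∈ ends e' → w = v)
    (hx : ∀ e ∈ E₂, x ∉ ends e) (hy : ∀ e ∈ E₁, y ∉ ends e) (hyx : y ≠ x)
    (hcut : ∀ s₂, s₂ ⊆ E₂ → y ∈ openCluster (ends '' (↑s₂ : Set ι)) v → y ∉ openCluster (ends '' (↑(E₂ \ s₂) : Set ι)) v)
    (h₂ : ∀ φ ψ : Set V → ℝ, Monotone φ → Monotone ψ →
      0 ≤ ∑ s ∈ E₂.powerset.filter (fun s : Finset ι => ¬ (y ∈ openCluster (ends '' (↑s : Set ι)) v ∧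
            y ∈ openCluster (ends '' (↑(E₂ \ s) : Set ι)) v)),
        (φ (openCluster (ends '' (↑s : Set ι)) v) - φ (openCluster (ends '' (↑(E₂ \ s) : Set ι)) v)) *
          (ψ (openCluster (ends '' (↑s : Set ι)) v) - ψ (openCluster (ends '' (↑(E₂ \ s) : Set ι)) v)))
    (f g : Set V → ℝ) (hf : Monotone f) (hg : Monotone g) :
    0 ≤ ∑ s ∈ (E₁ ∪ E₂).powerset.filter (fun s : Finset ι => ¬ (y ∈ openCluster (ends '' (↑s : Set ι)) x ∧
          y ∈ openCluster (ends '' (↑((E₁ ∪ E₂) \ s) : Set ι)) x)),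
      (f (openCluster (ends '' (↑s : Set ι)) x) - f (openCluster (ends '' (↑((E₁ ∪ E₂) \ s) : Set ι)) x)) *
        (g (openCluster (ends '' (↑s : Set ι)) x) - g (openCluster (ends '' (↑((E₁ ∪ E₂) \ s) : Set ι)) x)) :=
  noCore_series_core ends hE hsep hx hy hyx (fun ⟨s₂, hs₂, hz1, hz2⟩ => absurd hz2 (hcut s₂ hs₂ hz1)) h₂ f g hf hg

end Coefficientwise

end Summit.CriticalPhenomena.PercolationContinuityZ3.Theorems
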